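import Summits.Ventures.PercRepro.S1CoreCapChain

/-!
# PercRepro — LOCAL `e`-FREENESS: a set of rank `r` with `≥ 2r` points holds a circuit of `≤ r` elements avoiding
any given point (p2, gen 20; SUBCLAIM-S1 §6.0 v43 — the device of the `8`-point case, generalised)

On an `e`-free core, for `e ∈ F` with `r(F) = r` and `|F| ≥ 2r`: the `e`-free partition `E ∖ {e} = A ⊔ A'` meets `F`
in two sets of rank `≤ r − 1` (rank `r` would make the closure of the half equal to `cl F ∋ e`) covering `F ∖ {e}`
(`≥ 2r − 1` points), so one half has `≥ r` points of rank `≤ r − 1` — dependent — and holds a circuit `D ⊆ F ∖ {e}`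
with `≤ r` elements. For `r = 4` this is the lemma behind `s₅ ≤ 52` (S1FiveCircuitBase, proved there inline); for `r = 3` every plane
with `≥ 6` points holds a triangle avoiding any given point of it. It is the local input of the `s₅`-by-nullity
programme of §6.0 v43 (the five-circuits of a rank-`4` flat against its forced small circuits).

* **`exists_circuit_ncard_le_of_two_mul_le_ncard`** — the statement above.
Axioms: standard.
-/

open scoped Matroid

namespace PercRepro

namespace S1

open Set

variable {α : Type}

/-- **Local `e`-freeness**: on an `e`-free core, a set `F ⊆ E` of rank `r ≥ 1` with at least `2r` points holds, for
every `e ∈ F`, a circuit `D ⊆ F ∖ {e}` with at most `r` elements. -/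
theorem exists_circuit_ncard_le_of_two_mul_le_ncard (M : Matroid α) [M.Finite]
    (hfree : ∀ e ∈ M.E, ∃ A ⊆ M.E \ {e}, e ∉ M.closure A ∧ e ∉ M.closure ((M.E \ {e}) \ A))
    {F : Set α} (hFE : F ⊆ M.E) {r : ℕ} (hr1 : 1 ≤ r) (hrF : M.eRk F = r) (hF : 2 * r ≤ F.ncard)
    {e : α} (he : e ∈ F) :
    ∃ D ⊆ F \ {e}, M.IsCircuit D ∧ D.ncard ≤ r := by
  classical
  have hFfin : F.Finite := M.ground_finite.subset hFE
  obtain ⟨A, hA, heA, heA'⟩ := hfree e (hFE he)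
  -- the halves inside `F` have rank `≤ r − 1`
  have hrank : ∀ X ⊆ F, e ∉ M.closure X → M.eRk X ≤ (r - 1 : ℕ) := by
    intro X hXF heX
    by_contra hlt
    push Not at hlt
    have hr' : (r : ℕ∞) ≤ M.eRk X := by
      have h1 := Order.add_one_le_of_lt hlt
      have h2 : ((r - 1 : ℕ) : ℕ∞) + 1 = (r : ℕ∞) := by
        rw [← Nat.cast_succ]; congr 1; omega
      rw [h2] at h1
      exact h1
    have hcl : M.closure X = M.closure F :=
      (M.isRkFinite_of_finite (hFfin.subset hXF)).closure_eq_closure_of_subset_of_eRk_ge_eRk hXF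
        (by rw [hrF]; exact hr')
    exact heX (hcl ▸ M.subset_closure F hFE he)
  have hA1 : M.eRk (A ∩ F) ≤ (r - 1 : ℕ) :=
    hrank _ inter_subset_right (fun h => heA (M.closure_subset_closure inter_subset_left h))
  have hB1 : M.eRk (((M.E \ {e}) \ A) ∩ F) ≤ (r - 1 : ℕ) :=
    hrank _ inter_subset_right (fun h => heA' (M.closure_subset_closure inter_subset_left h))
  have hcover : F \ {e} ⊆ (A ∩ F) ∪ (((M.E \ {e}) \ A) ∩ F) := by
    intro x hx
    by_cases hxA : x ∈ A
    · exact Or.inl ⟨hxA, hx.1⟩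
    · exact Or.inr ⟨⟨⟨hFE hx.1, hx.2⟩, hxA⟩, hx.1⟩
  -- one half has `≥ r` points
  have hcard : r ≤ (A ∩ F).ncard ∨ r ≤ (((M.E \ {e}) \ A) ∩ F).ncard := by
    by_contra hno
    push Not at hno
    have h1 := ncard_le_ncard hcover
      ((hFfin.subset inter_subset_right).union (hFfin.subset inter_subset_right))
    have h2 := ncard_union_le (A ∩ F) (((M.E \ {e}) \ A) ∩ F)
    have h3 := ncard_sdiff_singleton_add_one he hFfin
    omega
  obtain ⟨X, hXF, heX, hXr, hXrk⟩ : ∃ X ⊆ F, e ∉ X ∧ r ≤ X.ncard ∧ M.eRk X ≤ (r - 1 : ℕ) := by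
    rcases hcard with h | h
    · exact ⟨A ∩ F, inter_subset_right, fun hx => (hA hx.1).2 rfl, h, hA1⟩
    · exact ⟨((M.E \ {e}) \ A) ∩ F, inter_subset_right, fun hx => hx.1.1.2 rfl, h, hB1⟩
  -- an `r`-subset of `X` is dependent; a circuit inside it
  obtain ⟨Y, hYX, hYr⟩ := Set.exists_subset_card_eq hXr
  have hYF : Y ⊆ F := hYX.trans hXF
  have hYfin : Y.Finite := hFfin.subset hYF
  have hYdep : M.Dep Y := by
    rw [← Matroid.eRk_lt_encard_iff_dep_of_finite hYfin (hYF.trans hFE)]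
    have hYenc : Y.encard = (r : ℕ∞) := by rw [← hYfin.cast_ncard_eq, hYr]
    rw [hYenc]
    calc M.eRk Y ≤ M.eRk X := M.eRk_mono hYX
      _ ≤ ((r - 1 : ℕ) : ℕ∞) := hXrk
      _ < (r : ℕ∞) := by exact_mod_cast (Nat.sub_lt hr1 one_pos)
  obtain ⟨D, hDY, hD⟩ := hYdep.exists_isCircuit_subset
  refine ⟨D, ?_, hD, ?_⟩
  · intro x hx
    refine ⟨hYF (hDY hx), fun hxe => ?_⟩
    rw [mem_singleton_iff] at hxe
    subst hxe
    exact heX (hYX (hDY hx))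
  · rw [← hYr]; exact ncard_le_ncard hDY hYfin

/-- **Planes**: a rank-`3` set with `≥ 6` points holds a triangle avoiding any given point of it. -/
theorem exists_triangle_of_six_le (M : Matroid α) [M.Finite]
    (hfree : ∀ e ∈ M.E, ∃ A ⊆ M.E \ {e}, e ∉ M.closure A ∧ e ∉ M.closure ((M.E \ {e}) \ A))
    {F : Set α} (hFE : F ⊆ M.E) (hrF : M.eRk F = 3) (hF : 6 ≤ F.ncard) {e : α} (he : e ∈ F) :
    ∃ D ⊆ F \ {e}, M.IsCircuit D ∧ D.ncard ≤ 3 :=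
  exists_circuit_ncard_le_of_two_mul_le_ncard M hfree hFE (r := 3) (by norm_num) (by rw [hrF]; rfl) (by omega) he

/-- **Solids**: a rank-`4` set with `≥ 8` points holds a circuit of `≤ 4` elements avoiding any given point. -/
theorem exists_circuit_le_four_of_eight_le (M : Matroid α) [M.Finite]
    (hfree : ∀ e ∈ M.E, ∃ A ⊆ M.E \ {e}, e ∉ M.closure A ∧ e ∉ M.closure ((M.E \ {e}) \ A))
    {F : Set α} (hFE : F ⊆ M.E) (hrF : M.eRk F = 4) (hF : 8 ≤ F.ncard) {e : α} (he : e ∈ F) :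
    ∃ D ⊆ F \ {e}, M.IsCircuit D ∧ D.ncard ≤ 4 :=
  exists_circuit_ncard_le_of_two_mul_le_ncard M hfree hFE (r := 4) (by norm_num) (by rw [hrF]; rfl) (by omega) he

end S1

end PercRepro
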